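import Literature.Topology.FourManifolds.RouteGraph2
import Literature.Topology.FourManifolds.K2Lite
import Mathlib.Analysis.SpecialFunctions.Trigonometric.Bounds
import HarnessLib

/-!
# The route of the slid attaching circle is a graph over the twisted height, I: from the tip to the landing

Topic `Literature/Topology/FourManifolds`; fact seat `provefact-IsStrictHandleSlide.isSurgery`
(R. C. Kirby, *The Topology of 4-Manifolds*, LNM 1374 (1989), Ch. I §4, Fig. 4.2; remaining
content: the named fact (S) `Literature.Topology.FourManifolds.FramedLink.IsStrictHandleSlide.slideModel`).
In the flat strip at the end of the slide band the band point `(x₀, h)` has slice polar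
coordinates `r = 1 + (1 - x₀) e h` (push-off radius normalised to `1`, `e` the edge rate) and
`θ = Θ h` (`Θ` decreasing). Along the lower track `(X₁, H₁)` of `K2Lite.lean` the route of the slid
circle is therefore the slice curve `r τ = 1 + (1 - X₁ τ) e (H₁ τ)`, `θ τ = Θ (H₁ τ)`, and the
sweep across the meridian disc needs its twisted height `y = r sin (twistAngle c r θ)` to be
strictly monotone (`RouteGraph.lean`). This file proves that on `[t_D, t_L]` (tip to landing),
from explicit smallness conditions on the tip depth `κ_D`, the bend width `u₁` and the slope `m_s`:

* `RouteHyp d` (structure: the strip functions `e`, `Θ` with bounds on the height window, the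
  twist `c` with the **tip condition** `e^{c r_D} tan (θ_D/2) = 1` (the tip is twisted to the
  vertical), a bound `VX` of the abscissa speed, a bound `CT` of `smoothTransition'`, and the
  conditions);
* `RouteHyp.strictAntiOn_y` — **`y` is strictly decreasing on `[t_D, t_L]`**; with the by-products
  `RouteHyp.twistAngle_tL_gt` (`α (t_L) > π/2`: the route has crossed the vertical before landing)
  and `RouteHyp.twistAngle_le` (`α ≤ π/2 + s₁` throughout).

Mechanism (`RouteGraph2.lean`): up to the start `t_ℓ` of the landing smoothing the radial speed is
robust (`ṙ ≤ -vmin e₋/2`) and `α` stays within `O(κ_D)` of the vertical (Lipschitz comparison), so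
the near-vertical criterion applies; on `[t_ℓ, t_L]` the height decreases strictly, `α > π/2` by
the climb `θ - (m_Θ m_s/2) Xl` non-decreasing from the end of the bend zone, and the landed
criterion applies.

## References

* R. C. Kirby, *The Topology of 4-Manifolds*, LNM 1374, Springer (1989), Ch. I §4. [Kirby1989]
-/

open scoped Topology ContDiff
open Set Real Filter

noncomputable section

namespace Literature.Topology.FourManifolds

/-- **Hypotheses for the monotonicity of the route between the tip and the landing.** See the
module docstring; the five displayed inequalities are the smallness conditions on `κ_D`, `u₁`,
`εℓ` and the largeness of `m_s`. [cite: Kirby1989, Ch. I §4] -/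
structure RouteHyp (d : K2LiteData) where
  e : ℝ → ℝ
  Θ : ℝ → ℝ
  c : ℝ
  w₁ : ℝ
  w₂ : ℝ
  emin : ℝ
  emax : ℝ
  Me : ℝ
  mΘ : ℝ
  MΘ : ℝ
  θmin : ℝ
  θmax : ℝ
  VX : ℝ
  CT : ℝ
  /-- The heights of the track on `[t_D, t_L]` lie in the window. -/
  hwin : ∀ τ ∈ Icc d.tD d.tL, d.H₁ τ ∈ Ioo w₁ w₂
  e_smooth : ContDiffOn ℝ ∞ e (Ioo w₁ w₂)
  Θ_smooth : ContDiffOn ℝ ∞ Θ (Ioo w₁ w₂)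
  e_bounds : ∀ h ∈ Ioo w₁ w₂, emin ≤ e h ∧ e h ≤ emax
  emin_pos : 0 < emin
  e_deriv : ∀ h ∈ Ioo w₁ w₂, |deriv e h| ≤ Me
  Θ_deriv : ∀ h ∈ Ioo w₁ w₂, -MΘ ≤ deriv Θ h ∧ deriv Θ h ≤ -mΘ
  mΘ_pos : 0 < mΘ
  Θ_mem : ∀ h ∈ Ioo w₁ w₂, Θ h ∈ Icc θmin θmax
  θmin_pos : 0 < θmin
  θmax_lt : θmax < π
  /-- **Tip condition**: the tip `(r_D, θ_D) = (1 + κ_D e h_D, Θ h_D)` is twisted to the vertical. -/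
  tip : exp (c * (1 + d.κD * e (d.Hh d.tD))) * tan (Θ (d.Hh d.tD) / 2) = 1
  VX_ge : ∀ τ ∈ Icc (d.b - d.ε) (d.b - d.ε / 2), deriv d.Xl τ ≤ VX
  CT_ge : ∀ x, deriv smoothTransition x ≤ CT
  CT_nonneg : 0 ≤ CT
  u₁_half : 2 * d.u₁ ≤ d.κD
  /-- COND0: `κ_D e₊ ≤ 1` (so `r ≤ 2`). -/
  cond0 : d.κD * emax ≤ 1
  /-- COND1: the radial speed is robust up to the landing smoothing. -/
  cond1 : 2 * d.κD * Me * (d.MH + d.ms * (1 + CT) * VX) ≤ d.vmin * emin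
  /-- COND2: the twist angle band is thin: `4 |c| s ≤ 1`, `s = |c| κ_D e₊ + K κ_D / vmin`. -/
  cond2 : 4 * |c| * (|c| * d.κD * emax + (exp (|c| * 2) / cos (θmax / 2) ^ 2 * MΘ * (d.MH + d.ms * (1 + CT) * VX)) * d.κD / d.vmin) ≤ 1
  /-- COND3: the mixed term is small against the radial speed. -/
  cond3 : 16 * (exp (|c| * 2) / cos (θmax / 2) ^ 2 * MΘ * (d.MH + d.ms * (1 + CT) * VX)) *
    (|c| * d.κD * emax + (exp (|c| * 2) / cos (θmax / 2) ^ 2 * MΘ * (d.MH + d.ms * (1 + CT) * VX)) * d.κD / d.vmin) < d.vmin * emin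
  /-- COND_s: the band half-width is at most `1/2`. -/
  cond_s : |c| * d.κD * emax + (exp (|c| * 2) / cos (θmax / 2) ^ 2 * MΘ * (d.MH + d.ms * (1 + CT) * VX)) * d.κD / d.vmin ≤ 2⁻¹
  /-- COND5: the climb beats the losses: `q₋ m_Θ m_s κ_D / 8 > u₁ L₁ + |c| κ_D e₊`. -/
  cond5 : d.u₁ * (|c| * emax + |c| * d.κD * Me * (d.MH + d.ms * (1 + CT) * VX) / d.vmin +
      exp (|c| * 2) / cos (θmax / 2) ^ 2 * MΘ * (d.MH + d.ms * (1 + CT) * VX) / d.vmin) + |c| * d.κD * emax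
    < exp (-(|c| * 2)) * mΘ * d.ms * d.κD / 8

namespace K2LiteData

variable (d : K2LiteData)

/-! ### The interval `[t_D, t_L]`: zone facts of the track -/

/-- `I_sub` (auxiliary). [folklore] -/
theorem I_sub {τ : ℝ} (hτ : τ ∈ Icc d.tD d.tL) : τ ∈ Icc (d.b - d.ε) (d.b - d.ε / 2) :=
  ⟨d.tD_mem.1.le.trans hτ.1, hτ.2.trans d.tL_mem.2.le⟩

/-- `lt_guard` (auxiliary). [folklore] -/
theorem lt_guard {τ : ℝ} (hτ : τ ∈ Icc d.tD d.tL) : τ < d.b + d.ε / 2 := by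
  linarith [(d.I_sub hτ).2, d.ε_pos]

/-- `le_bε` (auxiliary). [folklore] -/
theorem le_bε {τ : ℝ} (hτ : τ ∈ Icc d.tD d.tL) : τ ≤ d.b + d.ε := by linarith [(d.I_sub hτ).2, d.ε_pos]

/-- `Xg_eq` (auxiliary). [folklore] -/
theorem Xg_eq {τ : ℝ} (hτ : τ ∈ Icc d.tD d.tL) : d.Xg τ = d.Xl τ := d.Xg_of_le (d.lt_guard hτ).le

/-- `Xl_mem_I` (auxiliary). [folklore] -/
theorem Xl_mem_I {τ : ℝ} (hτ : τ ∈ Icc d.tD d.tL) : d.Xl τ ∈ Icc d.xD 1 :=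
  ⟨d.xD_le_Xl_of_tD_le hτ.1 (d.le_bε hτ), d.Xl_le_one_of_le_tL hτ.2⟩

/-- `Sr_zone` (auxiliary). [folklore] -/
theorem Sr_zone {τ : ℝ} (hτ : τ ∈ Icc d.tD d.tL) : d.Sr (d.Hh τ) ∈ Icc (d.κ₀ - 3 * d.κD) (d.κ₀ + 3 * d.κD) := by
  have hX := d.Xl_mem_I hτ
  have hρ := d.ρt_eq_of_lt_ρt (h := d.Hh τ) (by show 1 - d.κ₀ < d.Xl τ; linarith [hX.1, d.one_sub_κ₀_lt_xD])
  have e : d.Sr (d.Hh τ) = d.Xl τ - (1 - d.κ₀) := by show _ = d.ρt (d.Hh τ) - _; rw [hρ]; ring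
  have hxD : d.xD = 1 - d.κD := rfl
  rw [e]
  rw [hxD] at hX
  constructor <;> linarith [hX.1, hX.2, d.κD_pos]

/-- `vmin_le_dXl` (auxiliary). [folklore] -/
theorem vmin_le_dXl {τ : ℝ} (hτ : τ ∈ Icc d.tD d.tL) : d.vmin ≤ deriv d.Xl τ := d.vmin_le_deriv_Xl (d.I_sub hτ) (d.Sr_zone hτ)

/-- `deriv_Xl_nonneg_I` (auxiliary). [folklore] -/
theorem deriv_Xl_nonneg_I {τ : ℝ} (hτ : τ ∈ Icc d.tD d.tL) : 0 ≤ deriv d.Xl τ := d.vmin_pos.le.trans (d.vmin_le_dXl hτ)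

/-- On `[t_D, t_L]` the final blend has not started: near every point, `H₁ = P`. [folklore] -/
theorem H₁_eventuallyEq_P {τ : ℝ} (hτ : τ ∈ Icc d.tD d.tL) : d.H₁ =ᶠ[𝓝 τ] d.P := by
  have hlt : d.Xg τ < 1 + d.κD := by rw [d.Xg_eq hτ]; linarith [(d.Xl_mem_I hτ).2, d.κD_pos]
  have ho : IsOpen {σ | d.Xg σ < 1 + d.κD} := isOpen_lt d.contDiff_Xg.continuous continuous_const
  filter_upwards [ho.mem_nhds hlt] with σ hσ
  exact d.H₁_of_S₂_zero (d.S₂_of_le (le_of_lt hσ))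

/-- `H₁_eq_P` (auxiliary). [folklore] -/
theorem H₁_eq_P {τ : ℝ} (hτ : τ ∈ Icc d.tD d.tL) : d.H₁ τ = d.P τ := (d.H₁_eventuallyEq_P hτ).eq_of_nhds

/-- `X₁ ∈ [x_D, 1]` on `[t_D, t_L]`. [folklore] -/
theorem X₁_mem_I {τ : ℝ} (hτ : τ ∈ Icc d.tD d.tL) : d.X₁ τ ∈ Icc d.xD 1 := by
  have hX := d.Xl_mem_I hτ
  refine ⟨?_, (d.X₁_mem_Icc τ).2⟩
  have h := d.Xg_le_X₁_of_le (t := τ) (by rw [d.Xg_eq hτ]; exact hX.2)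
  rw [d.Xg_eq hτ] at h
  exact hX.1.trans h

/-- `one_sub_X₁_mem` (auxiliary). [folklore] -/
theorem one_sub_X₁_mem {τ : ℝ} (hτ : τ ∈ Icc d.tD d.tL) : 1 - d.X₁ τ ∈ Icc 0 d.κD := by
  have h := d.X₁_mem_I hτ
  rw [K2LiteData.xD] at h
  exact ⟨by linarith [h.2], by linarith [h.1]⟩

/-- **The derivative of the height on `[t_D, t_L]`**. [folklore] -/
theorem hasDerivAt_H₁_I {τ : ℝ} (hτ : τ ∈ Icc d.tD d.tL) :
    HasDerivAt d.H₁ (deriv d.Hh τ - d.ms * (deriv d.ζ (d.Xl τ - d.xD) * deriv d.Xl τ)) τ := by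
  have h := (d.hasDerivAt_P τ).congr_of_eventuallyEq (d.H₁_eventuallyEq_P hτ)
  rw [d.Xg_eq hτ, d.deriv_Xg_of_lt (d.lt_guard hτ)] at h
  exact h

/-- `deriv_H₁_eq_I` (auxiliary). [folklore] -/
theorem deriv_H₁_eq_I {τ : ℝ} (hτ : τ ∈ Icc d.tD d.tL) :
    deriv d.H₁ τ = deriv d.Hh τ - d.ms * (deriv d.ζ (d.Xl τ - d.xD) * deriv d.Xl τ) := (d.hasDerivAt_H₁_I hτ).deriv

/-- `deriv_H₁_le_I` (auxiliary). [folklore] -/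
theorem deriv_H₁_le_I {τ : ℝ} (hτ : τ ∈ Icc d.tD d.tL) : deriv d.H₁ τ ≤ d.MH := by
  rw [d.deriv_H₁_eq_I hτ]
  have h1 := d.deriv_Hh_le_MH ⟨(d.I_sub hτ).1, d.le_bε hτ⟩
  nlinarith [mul_nonneg d.ms_pos.le (mul_nonneg (d.deriv_ζ_nonneg (d.Xl τ - d.xD)) (d.deriv_Xl_nonneg_I hτ))]

/-! ### The abscissa through the landing smoothing -/

/-- The landing smoothing step `Sℓ = smoothStep (1 - εℓ) 1`. [folklore] -/
def Sℓ (x : ℝ) : ℝ := smoothStep (1 - d.εℓ) 1 x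

/-- `Sℓ_lt'` (auxiliary). [folklore] -/
theorem Sℓ_lt' : 1 - d.εℓ < (1 : ℝ) := by linarith [d.εℓ_pos]

/-- `Sℓ_mem` (auxiliary). [folklore] -/
theorem Sℓ_mem (x : ℝ) : d.Sℓ x ∈ Icc (0 : ℝ) 1 := smoothStep_mem_Icc _ _ _

/-- `Sℓ_of_le` (auxiliary). [folklore] -/
theorem Sℓ_of_le {x : ℝ} (hx : x ≤ 1 - d.εℓ) : d.Sℓ x = 0 := smoothStep_of_le d.Sℓ_lt' hx

/-- `deriv_Sℓ_nonneg` (auxiliary). [folklore] -/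
theorem deriv_Sℓ_nonneg (x : ℝ) : 0 ≤ deriv (smoothStep (1 - d.εℓ) 1) x := deriv_smoothStep_nonneg d.Sℓ_lt' x

/-- **The derivative of the abscissa on `[t_D, t_L]`**:
`X₁' = ((1 - Sℓ (Xl)) + (1 - Xl) Sℓ' (Xl)) · Xl'`. [folklore] -/
theorem hasDerivAt_X₁_I {τ : ℝ} (hτ : τ ∈ Icc d.tD d.tL) :
    HasDerivAt d.X₁ (((1 - d.Sℓ (d.Xl τ)) + (1 - d.Xl τ) * deriv (smoothStep (1 - d.εℓ) 1) (d.Xl τ)) * deriv d.Xl τ) τ := by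
  have hg : HasDerivAt d.Xg (deriv d.Xl τ) τ := by
    have := (d.contDiff_Xg.differentiable (by simp) τ).hasDerivAt
    rwa [d.deriv_Xg_of_lt (d.lt_guard hτ)] at this
  have hm := hasDerivAt_smoothMinConst 1 d.εℓ (d.Xg τ)
  have h := hm.comp τ hg
  rw [d.Xg_eq hτ] at h
  exact h

/-- `deriv_X₁_eq_I` (auxiliary). [folklore] -/
theorem deriv_X₁_eq_I {τ : ℝ} (hτ : τ ∈ Icc d.tD d.tL) :
    deriv d.X₁ τ = ((1 - d.Sℓ (d.Xl τ)) + (1 - d.Xl τ) * deriv (smoothStep (1 - d.εℓ) 1) (d.Xl τ)) * deriv d.Xl τ :=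
  (d.hasDerivAt_X₁_I hτ).deriv

/-- `1 - X₁ = (1 - Xl) (1 - Sℓ (Xl))` on `[t_D, t_L]`. [folklore] -/
theorem one_sub_X₁_eq {τ : ℝ} (hτ : τ ∈ Icc d.tD d.tL) : 1 - d.X₁ τ = (1 - d.Xl τ) * (1 - d.Sℓ (d.Xl τ)) := by
  rw [K2LiteData.X₁, d.Xg_eq hτ, smoothMinConst, Sℓ]; ring

/-- Up to the landing smoothing (`Xl ≤ 1 - εℓ`) the abscissa is the raw abscissa. [folklore] -/
theorem X₁_eq_Xl_I {τ : ℝ} (hτ : τ ∈ Icc d.tD d.tL) (hX : d.Xl τ ≤ 1 - d.εℓ) : d.X₁ τ = d.Xl τ := by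
  rw [d.X₁_eq_Xg_of_le (by rw [d.Xg_eq hτ]; exact hX), d.Xg_eq hτ]

/-! ### The level times `t_ℓ` (landing smoothing) and `t_u` (end of the bend zone) -/

/-- `exists_tℓ` (auxiliary). [folklore] -/
theorem exists_tℓ : ∃ t ∈ Ioo (d.b - d.ε) (d.b - d.ε / 2), d.Xl t = 1 - d.εℓ :=
  d.exists_level (by linarith [d.εℓ_lt_κD, d.κD_lt_κ₀]) (by linarith [d.κ₀_lt_one, d.εℓ_pos])

/-- `exists_tu` (auxiliary). [folklore] -/
theorem exists_tu : ∃ t ∈ Ioo (d.b - d.ε) (d.b - d.ε / 2), d.Xl t = d.xD + d.u₁ :=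
  d.exists_level (by rw [K2LiteData.xD]; linarith [d.κD_lt_κ₀, d.u₁_pos])
    (by rw [K2LiteData.xD]; linarith [d.κ₀_lt_one, d.u₁_le, d.κD_pos])

/-- The start of the landing smoothing: `Xl t_ℓ = 1 - εℓ`. [folklore] -/
def tℓ : ℝ := Classical.choose d.exists_tℓ

/-- The end of the bend zone: `Xl t_u = x_D + u₁`. [folklore] -/
def tu : ℝ := Classical.choose d.exists_tu

/-- `Xl_tℓ` (auxiliary). [folklore] -/
theorem Xl_tℓ : d.Xl d.tℓ = 1 - d.εℓ := (Classical.choose_spec d.exists_tℓ).2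
/-- `tℓ_mem` (auxiliary). [folklore] -/
theorem tℓ_mem : d.tℓ ∈ Ioo (d.b - d.ε) (d.b - d.ε / 2) := (Classical.choose_spec d.exists_tℓ).1
/-- `Xl_tu` (auxiliary). [folklore] -/
theorem Xl_tu : d.Xl d.tu = d.xD + d.u₁ := (Classical.choose_spec d.exists_tu).2
/-- `tu_mem` (auxiliary). [folklore] -/
theorem tu_mem : d.tu ∈ Ioo (d.b - d.ε) (d.b - d.ε / 2) := (Classical.choose_spec d.exists_tu).1

/-- `tD_lt_tu` (auxiliary). [folklore] -/
theorem tD_lt_tu : d.tD < d.tu := by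
  by_contra h
  have := d.Xl_le_Xl (le_of_not_gt h) (by linarith [d.tD_mem.2, d.ε_pos] : d.tD ≤ d.b + d.ε)
  rw [d.Xl_tu, d.Xl_tD] at this
  linarith [d.u₁_pos]

/-- `tℓ_lt_tL` (auxiliary). [folklore] -/
theorem tℓ_lt_tL : d.tℓ < d.tL := by
  by_contra h
  have := d.Xl_le_Xl (le_of_not_gt h) (by linarith [d.tℓ_mem.2, d.ε_pos] : d.tℓ ≤ d.b + d.ε)
  rw [d.Xl_tℓ, d.Xl_tL] at this
  linarith [d.εℓ_pos]

/-- `Xl_le_of_le_tℓ` (auxiliary). [folklore] -/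
theorem Xl_le_of_le_tℓ {τ : ℝ} (h : τ ≤ d.tℓ) : d.Xl τ ≤ 1 - d.εℓ := by
  rw [← d.Xl_tℓ]; exact d.Xl_le_Xl h (by linarith [d.tℓ_mem.2, d.ε_pos])

/-- `le_Xl_of_tu_le` (auxiliary). [folklore] -/
theorem le_Xl_of_tu_le {τ : ℝ} (h : d.tu ≤ τ) (hτ : τ ≤ d.b + d.ε) : d.xD + d.u₁ ≤ d.Xl τ := by
  rw [← d.Xl_tu]; exact d.Xl_le_Xl h hτ

/-- `le_Xl_of_tℓ_le` (auxiliary). [folklore] -/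
theorem le_Xl_of_tℓ_le {τ : ℝ} (h : d.tℓ ≤ τ) (hτ : τ ≤ d.b + d.ε) : 1 - d.εℓ ≤ d.Xl τ := by
  rw [← d.Xl_tℓ]; exact d.Xl_le_Xl h hτ

/-! ### Time is controlled by the abscissa -/

/-- **`vmin (τ - σ) ≤ Xl τ - Xl σ`** for `σ ≤ τ` in `[t_D, t_L]`. [folklore] -/
theorem time_le {σ τ : ℝ} (hσ : σ ∈ Icc d.tD d.tL) (hτ : τ ∈ Icc d.tD d.tL) (hστ : σ ≤ τ) :
    d.vmin * (τ - σ) ≤ d.Xl τ - d.Xl σ := by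
  have hmono : MonotoneOn (fun u ↦ d.Xl u - d.vmin * u) (Icc d.tD d.tL) := by
    refine monotoneOn_of_deriv_nonneg (convex_Icc _ _) ?_ ?_ ?_
    · exact (d.contDiff_Xl.continuous.sub (continuous_const.mul continuous_id)).continuousOn
    · exact ((d.contDiff_Xl.differentiable (by simp)).sub
        ((differentiable_const _).mul differentiable_id)).differentiableOn
    · intro u hu
      rw [interior_Icc] at hu
      have hd : HasDerivAt (fun u ↦ d.Xl u - d.vmin * u) (deriv d.Xl u - d.vmin * 1) u :=
        ((d.contDiff_Xl.differentiable (by simp) u).hasDerivAt).sub ((hasDerivAt_id u).const_mul d.vmin)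
      rw [hd.deriv]
      linarith [d.vmin_le_dXl (Ioo_subset_Icc_self hu)]
  have := hmono hσ hτ hστ
  simp only at this
  linarith

/-- `time_le_tD` (auxiliary). [folklore] -/
theorem time_le_tD {τ : ℝ} (hτ : τ ∈ Icc d.tD d.tL) : d.vmin * (τ - d.tD) ≤ d.Xl τ - d.xD := by
  have := d.time_le ⟨le_rfl, d.tD_lt_tL.le⟩ hτ hτ.1
  rwa [d.Xl_tD] at this

/-- `sub_tD_le` (auxiliary). [folklore] -/
theorem sub_tD_le {τ : ℝ} (hτ : τ ∈ Icc d.tD d.tL) : τ - d.tD ≤ d.κD / d.vmin := by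
  rw [le_div_iff₀ d.vmin_pos]
  have h := d.time_le_tD hτ
  have hX := (d.Xl_mem_I hτ).2
  rw [K2LiteData.xD] at h
  linarith

end K2LiteData

/-! ### Signed-twist forms of the comparison lemmas and of the near-vertical criterion -/

section Signed

variable {c : ℝ} {r θ dr dθ : ℝ → ℝ} {t₁ t₂ : ℝ}

/-- `c sin α ṙ ≥ |c| ṙ` for `ṙ ≤ 0`. [folklore] -/
theorem c_sin_mul_ge {c α x : ℝ} (hx : x ≤ 0) : |c| * x ≤ c * sin α * x := by
  have h : |c * sin α * x| ≤ |c| * (-x) := by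
    rw [abs_mul, abs_mul, abs_of_nonpos hx]
    have := abs_sin_le_one α
    nlinarith [abs_nonneg c, abs_nonneg (sin α), mul_nonneg (abs_nonneg c) (neg_nonneg.2 hx)]
  have := neg_abs_le (c * sin α * x)
  linarith

/-- `c sin α ṙ ≤ -|c| ṙ` for `ṙ ≤ 0`. [folklore] -/
theorem c_sin_mul_le {c α x : ℝ} (hx : x ≤ 0) : c * sin α * x ≤ -(|c| * x) := by
  have h : |c * sin α * x| ≤ |c| * (-x) := by
    rw [abs_mul, abs_mul, abs_of_nonpos hx]
    have := abs_sin_le_one α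
    nlinarith [abs_nonneg c, abs_nonneg (sin α), mul_nonneg (abs_nonneg c) (neg_nonneg.2 hx)]
  have := le_abs_self (c * sin α * x)
  linarith

/-- **Lower Lipschitz comparison, signed twist.** On `[t₁, t₂]` let `ṙ ≤ 0`, `θ ∈ (-π, π)` and
`twistQ · θ̇ ≥ -K`. Then `α t ≥ α t₁ + |c| (r t - r t₁) - K (t - t₁)`. [folklore] -/
theorem twistAngle_curve_ge_lip_abs (ht : t₁ ≤ t₂)
    (hr : ∀ t ∈ Icc t₁ t₂, HasDerivAt r (dr t) t) (hθ : ∀ t ∈ Icc t₁ t₂, HasDerivAt θ (dθ t) t)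
    (hθm : ∀ t ∈ Icc t₁ t₂, θ t ∈ Ioo (-π) π) (hdr : ∀ t ∈ Icc t₁ t₂, dr t ≤ 0)
    {K : ℝ} (hK : ∀ t ∈ Icc t₁ t₂, -K ≤ twistQ c (r t) (θ t) * dθ t)
    {t : ℝ} (htt : t ∈ Icc t₁ t₂) :
    twistAngle c (r t₁) (θ t₁) + |c| * (r t - r t₁) - K * (t - t₁) ≤ twistAngle c (r t) (θ t) := by
  set ψ : ℝ → ℝ := fun s ↦ twistAngle c (r s) (θ s) - |c| * r s + K * s with hψ
  have hψd : ∀ s ∈ Icc t₁ t₂, HasDerivAt ψ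
      ((c * sin (twistAngle c (r s) (θ s)) * dr s + twistQ c (r s) (θ s) * dθ s) - |c| * dr s + K * 1) s :=
    fun s hs ↦ ((hasDerivAt_twistAngle_curve c (hr s hs) (hθ s hs) (hθm s hs)).sub ((hr s hs).const_mul |c|)).add
      ((hasDerivAt_id s).const_mul K)
  have hmono : MonotoneOn ψ (Icc t₁ t₂) := by
    refine monotoneOn_of_deriv_nonneg (convex_Icc _ _) ?_ ?_ ?_
    · exact fun s hs ↦ (hψd s hs).continuousAt.continuousWithinAt
    · intro s hs
      rw [interior_Icc] at hs
      exact (hψd s (Ioo_subset_Icc_self hs)).differentiableAt.differentiableWithinAt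
    · intro s hs
      rw [interior_Icc] at hs
      have hs' := Ioo_subset_Icc_self hs
      rw [(hψd s hs').deriv]
      have h1 := c_sin_mul_ge (c := c) (α := twistAngle c (r s) (θ s)) (hdr s hs')
      have h4 := hK s hs'
      linarith
  have := hmono ⟨le_rfl, ht⟩ htt htt.1
  simp only [hψ] at this
  linarith

/-- **Upper Lipschitz comparison, signed twist.** On `[t₁, t₂]` let `ṙ ≤ 0`, `θ ∈ (-π, π)` and
`twistQ · θ̇ ≤ K`. Then `α t ≤ α t₁ + |c| (r t₁ - r t) + K (t - t₁)`. [folklore] -/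
theorem twistAngle_curve_le_lip_abs (ht : t₁ ≤ t₂)
    (hr : ∀ t ∈ Icc t₁ t₂, HasDerivAt r (dr t) t) (hθ : ∀ t ∈ Icc t₁ t₂, HasDerivAt θ (dθ t) t)
    (hθm : ∀ t ∈ Icc t₁ t₂, θ t ∈ Ioo (-π) π) (hdr : ∀ t ∈ Icc t₁ t₂, dr t ≤ 0)
    {K : ℝ} (hK : ∀ t ∈ Icc t₁ t₂, twistQ c (r t) (θ t) * dθ t ≤ K)
    {t : ℝ} (htt : t ∈ Icc t₁ t₂) :
    twistAngle c (r t) (θ t) ≤ twistAngle c (r t₁) (θ t₁) + |c| * (r t₁ - r t) + K * (t - t₁) := by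
  set ψ : ℝ → ℝ := fun s ↦ twistAngle c (r s) (θ s) + |c| * r s - K * s with hψ
  have hψd : ∀ s ∈ Icc t₁ t₂, HasDerivAt ψ
      ((c * sin (twistAngle c (r s) (θ s)) * dr s + twistQ c (r s) (θ s) * dθ s) + |c| * dr s - K * 1) s :=
    fun s hs ↦ ((hasDerivAt_twistAngle_curve c (hr s hs) (hθ s hs) (hθm s hs)).add ((hr s hs).const_mul |c|)).sub
      ((hasDerivAt_id s).const_mul K)
  have hanti : AntitoneOn ψ (Icc t₁ t₂) := by
    refine antitoneOn_of_deriv_nonpos (convex_Icc _ _) ?_ ?_ ?_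
    · exact fun s hs ↦ (hψd s hs).continuousAt.continuousWithinAt
    · intro s hs
      rw [interior_Icc] at hs
      exact (hψd s (Ioo_subset_Icc_self hs)).differentiableAt.differentiableWithinAt
    · intro s hs
      rw [interior_Icc] at hs
      have hs' := Ioo_subset_Icc_self hs
      rw [(hψd s hs').deriv]
      have h1 := c_sin_mul_le (c := c) (α := twistAngle c (r s) (θ s)) (hdr s hs')
      have h4 := hK s hs'
      linarith
  have := hanti ⟨le_rfl, ht⟩ htt htt.1
  simp only [hψ] at this
  linarith

/-- **Lower comparison with the angular gain, signed twist.** On `[t₁, t₂]` let `ṙ ≤ 0 ≤ θ̇`,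
`θ ∈ (-π, π)` and `twistQ ≥ q_min`. Then `α t ≥ α t₁ + |c| (r t - r t₁) + q_min (θ t - θ t₁)`.
[folklore] -/
theorem twistAngle_curve_ge_abs (ht : t₁ ≤ t₂)
    (hr : ∀ t ∈ Icc t₁ t₂, HasDerivAt r (dr t) t) (hθ : ∀ t ∈ Icc t₁ t₂, HasDerivAt θ (dθ t) t)
    (hθm : ∀ t ∈ Icc t₁ t₂, θ t ∈ Ioo (-π) π) (hdr : ∀ t ∈ Icc t₁ t₂, dr t ≤ 0)
    (hdθ : ∀ t ∈ Icc t₁ t₂, 0 ≤ dθ t) {qmin : ℝ} (hq : ∀ t ∈ Icc t₁ t₂, qmin ≤ twistQ c (r t) (θ t))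
    {t : ℝ} (htt : t ∈ Icc t₁ t₂) :
    twistAngle c (r t₁) (θ t₁) + |c| * (r t - r t₁) + qmin * (θ t - θ t₁) ≤ twistAngle c (r t) (θ t) := by
  set ψ : ℝ → ℝ := fun s ↦ twistAngle c (r s) (θ s) - |c| * r s - qmin * θ s with hψ
  have hψd : ∀ s ∈ Icc t₁ t₂, HasDerivAt ψ
      ((c * sin (twistAngle c (r s) (θ s)) * dr s + twistQ c (r s) (θ s) * dθ s) - |c| * dr s - qmin * dθ s) s :=
    fun s hs ↦ ((hasDerivAt_twistAngle_curve c (hr s hs) (hθ s hs) (hθm s hs)).sub ((hr s hs).const_mul |c|)).sub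
      ((hθ s hs).const_mul qmin)
  have hmono : MonotoneOn ψ (Icc t₁ t₂) := by
    refine monotoneOn_of_deriv_nonneg (convex_Icc _ _) ?_ ?_ ?_
    · exact fun s hs ↦ (hψd s hs).continuousAt.continuousWithinAt
    · intro s hs
      rw [interior_Icc] at hs
      exact (hψd s (Ioo_subset_Icc_self hs)).differentiableAt.differentiableWithinAt
    · intro s hs
      rw [interior_Icc] at hs
      have hs' := Ioo_subset_Icc_self hs
      rw [(hψd s hs').deriv]
      have h1 := c_sin_mul_ge (c := c) (α := twistAngle c (r s) (θ s)) (hdr s hs')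
      have h3 := hdθ s hs'; have h4 := hq s hs'
      nlinarith [mul_nonneg (sub_nonneg.2 h4) h3]
  have := hmono ⟨le_rfl, ht⟩ htt htt.1
  simp only [hψ] at this
  linarith

/-- **Near-vertical criterion, signed twist**: `|cos α| ≤ s`, `R |c| s ≤ 1/2`, `ṙ < 0` and
`R q |θ̇| s < -ṙ sin α / 2` give `ẏ < 0`. [folklore] -/
theorem curveY_deriv_neg_of_nearVertical_abs {c R r' θ' α q : ℝ} (hR : 0 < R) (hr : r' < 0)
    (hsin : 0 < sin α) (hq : 0 ≤ q) {s : ℝ} (hcos : |cos α| ≤ s) (hband : R * |c| * s ≤ 1 / 2)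
    (hmix : R * q * |θ'| * s < -r' * sin α / 2) :
    r' * sin α + R * (cos α * (c * sin α * r' + q * θ')) < 0 := by
  rw [curveY_deriv_eq]
  have hcu : cos α ≤ s := (abs_le.1 hcos).2
  have hk : r' * sin α < 0 := mul_neg_of_neg_of_pos hr hsin
  -- `|R c cos α| ≤ R |c| s`
  have hcc : |R * c * cos α| ≤ R * |c| * s := by
    rw [abs_mul, abs_mul, abs_of_pos hR]
    exact mul_le_mul_of_nonneg_left hcos (mul_nonneg hR.le (abs_nonneg _))
  have h1 : 1 - R * |c| * s ≤ 1 + R * c * cos α := by have := neg_abs_le (R * c * cos α); linarith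
  have h2 : r' * sin α * (1 + R * c * cos α) ≤ r' * sin α * (1 - R * |c| * s) :=
    mul_le_mul_of_nonpos_left h1 hk.le
  have h3 : r' * sin α * (1 - R * |c| * s) ≤ r' * sin α * (1 / 2) :=
    mul_le_mul_of_nonpos_left (by linarith) hk.le
  have h4 : R * cos α * q * θ' ≤ R * q * |θ'| * s := by
    have e : R * cos α * q * θ' = (R * q) * (cos α * θ') := by ring
    have e' : R * q * |θ'| * s = (R * q) * (|θ'| * s) := by ring
    rw [e, e']
    refine mul_le_mul_of_nonneg_left ?_ (by positivity)
    calc cos α * θ' ≤ |cos α * θ'| := le_abs_self _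
      _ = |cos α| * |θ'| := abs_mul _ _
      _ ≤ s * |θ'| := mul_le_mul_of_nonneg_right hcos (abs_nonneg _)
      _ = |θ'| * s := mul_comm _ _
  nlinarith

end Signed

namespace RouteHyp

variable {d : K2LiteData} (R : RouteHyp d)

/-! ### The derived constants -/

/-- The bound `MḢ = MH + m_s (1 + CT) VX` of `|H₁'|` on `[t_D, t_L]`. [folklore] -/
def MH' : ℝ := d.MH + d.ms * (1 + R.CT) * R.VX

/-- The upper bound `q₊ = e^{2c}/cos²(θmax/2)` of `twistQ` on the route. [folklore] -/
def qmax : ℝ := exp (|R.c| * 2) / cos (R.θmax / 2) ^ 2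

/-- The lower bound `q₋ = e^{-2c}` of `twistQ` on the route. [folklore] -/
def qmin : ℝ := exp (-(|R.c| * 2))

/-- The Lipschitz constant `K = q₊ MΘ MḢ` of the twist angle along the route. [folklore] -/
def K : ℝ := R.qmax * R.MΘ * R.MH'

/-- The half-width `s = c κ_D e₊ + K κ_D / vmin` of the twist-angle band about the vertical. [folklore] -/
def s : ℝ := |R.c| * d.κD * R.emax + R.K * d.κD / d.vmin

/-- The loss constant `L₁` of the bend zone. [folklore] -/
def L₁ : ℝ := |R.c| * R.emax + |R.c| * d.κD * R.Me * R.MH' / d.vmin + R.K / d.vmin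

/-- `MH'_def` (auxiliary). [folklore] -/
theorem MH'_def : R.MH' = d.MH + d.ms * (1 + R.CT) * R.VX := rfl
/-- `K_def` (auxiliary). [folklore] -/
theorem K_def : R.K = R.qmax * R.MΘ * R.MH' := rfl
/-- `s_def` (auxiliary). [folklore] -/
theorem s_def : R.s = |R.c| * d.κD * R.emax + R.K * d.κD / d.vmin := rfl

/-- `emax_pos` (auxiliary). [folklore] -/
theorem emax_pos : 0 < R.emax := by
  obtain ⟨τ, hτ⟩ : ∃ τ, τ ∈ Icc d.tD d.tL := ⟨d.tD, le_rfl, d.tD_lt_tL.le⟩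
  have h := R.e_bounds _ (R.hwin τ hτ)
  linarith [R.emin_pos, h.1, h.2]

/-- `Me_nonneg` (auxiliary). [folklore] -/
theorem Me_nonneg : 0 ≤ R.Me := by
  obtain ⟨τ, hτ⟩ : ∃ τ, τ ∈ Icc d.tD d.tL := ⟨d.tD, le_rfl, d.tD_lt_tL.le⟩
  exact (abs_nonneg _).trans (R.e_deriv _ (R.hwin τ hτ))

/-- `MΘ_pos` (auxiliary). [folklore] -/
theorem MΘ_pos : 0 < R.MΘ := by
  obtain ⟨τ, hτ⟩ : ∃ τ, τ ∈ Icc d.tD d.tL := ⟨d.tD, le_rfl, d.tD_lt_tL.le⟩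
  have h := R.Θ_deriv _ (R.hwin τ hτ)
  linarith [R.mΘ_pos, h.1, h.2]

/-- `θmin_le_θmax` (auxiliary). [folklore] -/
theorem θmin_le_θmax : R.θmin ≤ R.θmax := by
  obtain ⟨τ, hτ⟩ : ∃ τ, τ ∈ Icc d.tD d.tL := ⟨d.tD, le_rfl, d.tD_lt_tL.le⟩
  have h := R.Θ_mem _ (R.hwin τ hτ)
  exact h.1.trans h.2

/-- `VX_pos` (auxiliary). [folklore] -/
theorem VX_pos : 0 < R.VX := by
  have ht := d.tD_mem
  have hzone : d.Sr (d.Hh d.tD) ∈ Icc (d.κ₀ - 3 * d.κD) (d.κ₀ + 3 * d.κD) := by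
    have hρ := d.ρt_eq_of_lt_ρt (h := d.Hh d.tD) (by rw [d.ρt_Hh_tD]; exact d.one_sub_κ₀_lt_xD)
    have e : d.Sr (d.Hh d.tD) = d.xD - (1 - d.κ₀) := by
      have := d.ρt_Hh_tD; rw [hρ] at this; linarith
    rw [e, K2LiteData.xD]; constructor <;> linarith [d.κD_pos]
  have h1 := d.vmin_le_deriv_Xl ⟨ht.1.le, ht.2.le⟩ hzone
  have h2 := R.VX_ge d.tD ⟨ht.1.le, ht.2.le⟩
  linarith [d.vmin_pos]

/-- `MH'_pos` (auxiliary). [folklore] -/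
theorem MH'_pos : 0 < R.MH' := by
  rw [MH']; have := d.MH_pos
  nlinarith [mul_nonneg (mul_nonneg d.ms_pos.le (by linarith [R.CT_nonneg] : (0:ℝ) ≤ 1 + R.CT)) R.VX_pos.le]

/-- `cos_half_pos` (auxiliary). [folklore] -/
theorem cos_half_pos : 0 < cos (R.θmax / 2) := by
  have h1 := R.θmax_lt; have h2 := R.θmin_pos; have h3 := R.θmin_le_θmax
  exact cos_pos_of_mem_Ioo ⟨by linarith [pi_pos], by linarith⟩

/-- `qmax_pos` (auxiliary). [folklore] -/
theorem qmax_pos : 0 < R.qmax := div_pos (exp_pos _) (pow_pos R.cos_half_pos 2)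
/-- `qmin_pos` (auxiliary). [folklore] -/
theorem qmin_pos : 0 < R.qmin := exp_pos _
/-- `K_pos` (auxiliary). [folklore] -/
theorem K_pos : 0 < R.K := mul_pos (mul_pos R.qmax_pos R.MΘ_pos) R.MH'_pos

/-- `s_nonneg` (auxiliary). [folklore] -/
theorem s_nonneg : 0 ≤ R.s := by
  rw [s]; exact add_nonneg (mul_nonneg (mul_nonneg (abs_nonneg _) d.κD_pos.le) R.emax_pos.le)
    (div_nonneg (mul_nonneg R.K_pos.le d.κD_pos.le) d.vmin_pos.le)

/-- `cs_le` (auxiliary). [folklore] -/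
theorem cs_le : 4 * |R.c| * R.s ≤ 1 := R.cond2
/-- `s_le_half` (auxiliary). [folklore] -/
theorem s_le_half : R.s ≤ 2⁻¹ := R.cond_s
/-- `Ks_lt` (auxiliary). [folklore] -/
theorem Ks_lt : 16 * R.K * R.s < d.vmin * R.emin := R.cond3
/-- `climb_gt` (auxiliary). [folklore] -/
theorem climb_gt : d.u₁ * R.L₁ + |R.c| * d.κD * R.emax < R.qmin * R.mΘ * d.ms * d.κD / 8 := by
  have := R.cond5; rw [L₁, K, qmax, MH', qmin]; exact this

/-! ### The curve -/

/-- The slice radius along the route, `1 + (1 - X₁) e (H₁)`. [folklore] -/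
def r (τ : ℝ) : ℝ := 1 + (1 - d.X₁ τ) * R.e (d.H₁ τ)

/-- The slice angle along the route, `Θ (H₁)`. [folklore] -/
def θ (τ : ℝ) : ℝ := R.Θ (d.H₁ τ)

/-- The twist angle along the route. [folklore] -/
def α (τ : ℝ) : ℝ := twistAngle R.c (R.r τ) (R.θ τ)

/-- **The twisted height along the route.** [folklore] -/
def y (τ : ℝ) : ℝ := R.r τ * sin (R.α τ)

/-- `r_def` (auxiliary). [folklore] -/
theorem r_def (τ : ℝ) : R.r τ = 1 + (1 - d.X₁ τ) * R.e (d.H₁ τ) := rfl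
/-- `θ_def` (auxiliary). [folklore] -/
theorem θ_def (τ : ℝ) : R.θ τ = R.Θ (d.H₁ τ) := rfl
/-- `y_def` (auxiliary). [folklore] -/
theorem y_def (τ : ℝ) : R.y τ = R.r τ * sin (twistAngle R.c (R.r τ) (R.θ τ)) := rfl

/-- `deriv_Xl_le` (auxiliary). [folklore] -/
theorem deriv_Xl_le {τ : ℝ} (hτ : τ ∈ Icc d.tD d.tL) : deriv d.Xl τ ≤ R.VX := R.VX_ge τ (d.I_sub hτ)

/-! ### The height window along the route -/

/-- `e_mem` (auxiliary). [folklore] -/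
theorem e_mem {τ : ℝ} (hτ : τ ∈ Icc d.tD d.tL) : R.emin ≤ R.e (d.H₁ τ) ∧ R.e (d.H₁ τ) ≤ R.emax :=
  R.e_bounds _ (R.hwin τ hτ)

/-- `e_pos` (auxiliary). [folklore] -/
theorem e_pos {τ : ℝ} (hτ : τ ∈ Icc d.tD d.tL) : 0 < R.e (d.H₁ τ) := R.emin_pos.trans_le (R.e_mem hτ).1

/-- `r ∈ [1, 1 + κ_D e₊] ⊆ [1, 2]` on `[t_D, t_L]`. [folklore] -/
theorem r_mem {τ : ℝ} (hτ : τ ∈ Icc d.tD d.tL) : R.r τ ∈ Icc (1 : ℝ) (1 + d.κD * R.emax) := by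
  have h1 := d.one_sub_X₁_mem hτ; have h2 := R.e_mem hτ
  rw [r]; constructor <;> nlinarith [h1.1, h1.2, h2.1, h2.2, R.emin_pos]

/-- `r_pos` (auxiliary). [folklore] -/
theorem r_pos {τ : ℝ} (hτ : τ ∈ Icc d.tD d.tL) : 0 < R.r τ := by linarith [(R.r_mem hτ).1]

/-- `r_le_two` (auxiliary). [folklore] -/
theorem r_le_two {τ : ℝ} (hτ : τ ∈ Icc d.tD d.tL) : R.r τ ≤ 2 := by linarith [(R.r_mem hτ).2, R.cond0]

/-- `θ_mem` (auxiliary). [folklore] -/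
theorem θ_mem {τ : ℝ} (hτ : τ ∈ Icc d.tD d.tL) : R.θ τ ∈ Icc R.θmin R.θmax := R.Θ_mem _ (R.hwin τ hτ)

/-- `θ_mem_Ioo` (auxiliary). [folklore] -/
theorem θ_mem_Ioo {τ : ℝ} (hτ : τ ∈ Icc d.tD d.tL) : R.θ τ ∈ Ioo (-π) π :=
  ⟨by linarith [(R.θ_mem hτ).1, R.θmin_pos, pi_pos], (R.θ_mem hτ).2.trans_lt R.θmax_lt⟩

/-- `θ_mem_Ico` (auxiliary). [folklore] -/
theorem θ_mem_Ico {τ : ℝ} (hτ : τ ∈ Icc d.tD d.tL) : R.θ τ ∈ Ico 0 π :=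
  ⟨(R.θmin_pos.trans_le (R.θ_mem hτ).1).le, (R.θ_mem hτ).2.trans_lt R.θmax_lt⟩

/-- `θ_pos` (auxiliary). [folklore] -/
theorem θ_pos {τ : ℝ} (hτ : τ ∈ Icc d.tD d.tL) : 0 < R.θ τ := R.θmin_pos.trans_le (R.θ_mem hτ).1

/-- The bounds of `twistQ` on the route. [folklore] -/
theorem twistQ_mem {τ : ℝ} (hτ : τ ∈ Icc d.tD d.tL) : R.qmin ≤ twistQ R.c (R.r τ) (R.θ τ) ∧ twistQ R.c (R.r τ) (R.θ τ) ≤ R.qmax := by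
  have hr := R.r_mem hτ; have hr2 := R.r_le_two hτ; have hθ := R.θ_mem hτ
  have hθ' := R.θ_mem_Ioo hτ
  set E := exp (R.c * R.r τ) with hE
  have hEp : 0 < E := exp_pos _
  have hcr : |R.c * R.r τ| ≤ |R.c| * 2 := by
    rw [abs_mul, abs_of_nonneg (by linarith [hr.1] : 0 ≤ R.r τ)]
    exact mul_le_mul_of_nonneg_left hr2 (abs_nonneg _)
  have hEle : E ≤ exp (|R.c| * 2) := exp_le_exp.2 ((le_abs_self _).trans hcr)
  have hEge : exp (-(|R.c| * 2)) ≤ E := exp_le_exp.2 (by have := (abs_le.1 hcr).1; linarith)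
  have hc0 : 0 < cos (R.θ τ / 2) := cos_pos_of_mem_Ioo ⟨by linarith [hθ'.1], by linarith [hθ'.2]⟩
  have hcos : cos (R.θmax / 2) ≤ cos (R.θ τ / 2) := by
    apply cos_le_cos_of_nonneg_of_le_pi
    · linarith [R.θ_pos hτ]
    · linarith [R.θmax_lt, pi_pos]
    · linarith [hθ.2]
  have hcs : cos (R.θ τ / 2) ^ 2 + sin (R.θ τ / 2) ^ 2 = 1 := cos_sq_add_sin_sq _
  have hden_pos : 0 < cos (R.θ τ / 2) ^ 2 + E ^ 2 * sin (R.θ τ / 2) ^ 2 := by positivity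
  rw [twistQ, ← hE]
  constructor
  · -- lower bound `min (E, 1/E) ≥ e^{-2|c|}`
    rw [qmin]
    rcases le_or_gt 1 E with hE1 | hE1
    · have hden_le : cos (R.θ τ / 2) ^ 2 + E ^ 2 * sin (R.θ τ / 2) ^ 2 ≤ E ^ 2 := by
        have hE2 : 1 ≤ E ^ 2 := by nlinarith
        nlinarith [mul_nonneg (sub_nonneg.2 hE2) (sq_nonneg (cos (R.θ τ / 2)))]
      calc exp (-(|R.c| * 2)) ≤ E⁻¹ := by
            rw [hE, ← exp_neg]; exact exp_le_exp.2 (by have := (abs_le.1 hcr).2; linarith)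
        _ = E / E ^ 2 := by field_simp
        _ ≤ E / (cos (R.θ τ / 2) ^ 2 + E ^ 2 * sin (R.θ τ / 2) ^ 2) :=
            div_le_div_of_nonneg_left hEp.le hden_pos hden_le
    · have hden_le : cos (R.θ τ / 2) ^ 2 + E ^ 2 * sin (R.θ τ / 2) ^ 2 ≤ 1 := by
        have hE2 : E ^ 2 ≤ 1 := by nlinarith
        nlinarith [mul_nonneg (sub_nonneg.2 hE2) (sq_nonneg (sin (R.θ τ / 2)))]
      calc exp (-(|R.c| * 2)) ≤ E := hEge
        _ = E / 1 := (div_one E).symm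
        _ ≤ E / (cos (R.θ τ / 2) ^ 2 + E ^ 2 * sin (R.θ τ / 2) ^ 2) :=
            div_le_div_of_nonneg_left hEp.le hden_pos hden_le
  · -- upper bound
    rw [qmax]
    have hc2 : 0 < cos (R.θmax / 2) ^ 2 := pow_pos R.cos_half_pos 2
    calc E / (cos (R.θ τ / 2) ^ 2 + E ^ 2 * sin (R.θ τ / 2) ^ 2) ≤ E / cos (R.θmax / 2) ^ 2 := by
          apply div_le_div_of_nonneg_left hEp.le hc2
          nlinarith [mul_nonneg (sq_nonneg E) (sq_nonneg (sin (R.θ τ / 2))),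
            mul_self_le_mul_self R.cos_half_pos.le hcos]
      _ ≤ exp (|R.c| * 2) / cos (R.θmax / 2) ^ 2 := div_le_div_of_nonneg_right hEle hc2.le

/-! ### Derivatives along the route -/

/-- The derivative of `ζ` is in `[0, 1 + CT]`. [folklore] -/
theorem deriv_ζ_mem (u : ℝ) : deriv d.ζ u ∈ Icc (0 : ℝ) (1 + R.CT) := by
  refine ⟨d.deriv_ζ_nonneg u, ?_⟩
  rw [(d.hasDerivAt_ζ u).deriv]
  have hS := smoothStep_mem_Icc 0 d.u₁ u
  have hS' : u * deriv (smoothStep 0 d.u₁) u ≤ R.CT := by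
    rw [(hasDerivAt_smoothStep 0 d.u₁ u).deriv]
    rcases le_or_gt u 0 with hu | hu
    · -- left of `0` the transition derivative vanishes... we only need `≤ CT`: `u ≤ 0` and the derivative `≥ 0`
      have h1 : 0 ≤ deriv smoothTransition ((u - 0) / (d.u₁ - 0)) :=
        (((smoothTransition.contDiff (n := 1)).differentiable one_ne_zero) _).hasDerivAt.nonneg_of_monotone
          smoothTransition.monotone
      have h2 : 0 ≤ (d.u₁ - 0)⁻¹ := inv_nonneg.2 (by linarith [d.u₁_pos])
      nlinarith [mul_nonneg h1 h2, R.CT_nonneg]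
    rcases le_or_gt u d.u₁ with hu1 | hu1
    · have h1 := R.CT_ge ((u - 0) / (d.u₁ - 0))
      have h1' : 0 ≤ deriv smoothTransition ((u - 0) / (d.u₁ - 0)) :=
        (((smoothTransition.contDiff (n := 1)).differentiable one_ne_zero) _).hasDerivAt.nonneg_of_monotone
          smoothTransition.monotone
      have hu' : u * (d.u₁ - 0)⁻¹ ≤ 1 := by
        rw [sub_zero, mul_inv_le_iff₀ d.u₁_pos]; linarith
      calc u * (deriv smoothTransition ((u - 0) / (d.u₁ - 0)) * (d.u₁ - 0)⁻¹)
          = (u * (d.u₁ - 0)⁻¹) * deriv smoothTransition ((u - 0) / (d.u₁ - 0)) := by ring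
        _ ≤ 1 * R.CT := mul_le_mul hu' h1 h1' zero_le_one
        _ = R.CT := one_mul _
    · -- right of `u₁` the smooth step is constant
      have : deriv smoothTransition ((u - 0) / (d.u₁ - 0)) = 0 := by
        have hx : 1 < (u - 0) / (d.u₁ - 0) := by rw [sub_zero, sub_zero, one_lt_div d.u₁_pos]; exact hu1
        have hev : smoothTransition =ᶠ[𝓝 ((u - 0) / (d.u₁ - 0))] fun _ ↦ (1 : ℝ) :=
          Filter.eventuallyEq_of_mem (Ioi_mem_nhds hx) fun z hz ↦ smoothTransition.one_of_one_le (le_of_lt hz)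
        rw [hev.deriv_eq, deriv_const]
      rw [this]; simp [R.CT_nonneg]
  linarith [hS.2]

/-- `abs_deriv_H₁_le` (auxiliary). [folklore] -/
theorem abs_deriv_H₁_le {τ : ℝ} (hτ : τ ∈ Icc d.tD d.tL) : |deriv d.H₁ τ| ≤ R.MH' := by
  rw [abs_le, MH', d.deriv_H₁_eq_I hτ]
  have h1 := d.deriv_Hh_le_MH ⟨(d.I_sub hτ).1, d.le_bε hτ⟩
  have h2 := d.deriv_Hh_pos (t := τ) (d.le_bε hτ)
  have hζ := R.deriv_ζ_mem (d.Xl τ - d.xD)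
  have hX := R.deriv_Xl_le hτ; have hX0 := d.deriv_Xl_nonneg_I hτ
  have hprod : deriv d.ζ (d.Xl τ - d.xD) * deriv d.Xl τ ≤ (1 + R.CT) * R.VX :=
    mul_le_mul hζ.2 hX hX0 (by linarith [R.CT_nonneg])
  have hms := d.ms_pos
  constructor
  · nlinarith [mul_le_mul_of_nonneg_left hprod hms.le, mul_nonneg (mul_nonneg hms.le (by linarith [R.CT_nonneg] : (0:ℝ) ≤ 1 + R.CT)) R.VX_pos.le]
  · nlinarith [mul_nonneg hms.le (mul_nonneg hζ.1 hX0), mul_nonneg (mul_nonneg hms.le (by linarith [R.CT_nonneg] : (0:ℝ) ≤ 1 + R.CT)) R.VX_pos.le]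

/-- Differentiability of `e` and `Θ` at the heights of the route. [folklore] -/
theorem hasDerivAt_e {τ : ℝ} (hτ : τ ∈ Icc d.tD d.tL) : HasDerivAt R.e (deriv R.e (d.H₁ τ)) (d.H₁ τ) :=
  ((R.e_smooth.differentiableOn (by simp)).differentiableAt (Ioo_mem_nhds (R.hwin τ hτ).1 (R.hwin τ hτ).2)).hasDerivAt

/-- `hasDerivAt_Θ` (auxiliary). [folklore] -/
theorem hasDerivAt_Θ {τ : ℝ} (hτ : τ ∈ Icc d.tD d.tL) : HasDerivAt R.Θ (deriv R.Θ (d.H₁ τ)) (d.H₁ τ) :=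
  ((R.Θ_smooth.differentiableOn (by simp)).differentiableAt (Ioo_mem_nhds (R.hwin τ hτ).1 (R.hwin τ hτ).2)).hasDerivAt

/-- **The radial derivative** `ṙ = -X₁' e (H₁) + (1 - X₁) e' (H₁) H₁'`. [folklore] -/
theorem hasDerivAt_r {τ : ℝ} (hτ : τ ∈ Icc d.tD d.tL) :
    HasDerivAt R.r (-deriv d.X₁ τ * R.e (d.H₁ τ) + (1 - d.X₁ τ) * (deriv R.e (d.H₁ τ) * deriv d.H₁ τ)) τ := by
  have hX : HasDerivAt d.X₁ (deriv d.X₁ τ) τ := (d.contDiff_X₁.differentiable (by simp) τ).hasDerivAt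
  have hH : HasDerivAt d.H₁ (deriv d.H₁ τ) τ := (d.contDiff_H₁.differentiable (by simp) τ).hasDerivAt
  have he := (R.hasDerivAt_e hτ).comp τ hH
  have h := ((hX.const_sub 1).mul he).const_add 1
  refine (h.congr_of_eventuallyEq (Eventually.of_forall fun σ ↦ rfl)).congr_deriv ?_
  simp only [Function.comp_def]

/-- **The angular derivative** `θ̇ = Θ' (H₁) H₁'`. [folklore] -/
theorem hasDerivAt_θ {τ : ℝ} (hτ : τ ∈ Icc d.tD d.tL) :
    HasDerivAt R.θ (deriv R.Θ (d.H₁ τ) * deriv d.H₁ τ) τ := by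
  have hH : HasDerivAt d.H₁ (deriv d.H₁ τ) τ := (d.contDiff_H₁.differentiable (by simp) τ).hasDerivAt
  exact (R.hasDerivAt_Θ hτ).comp τ hH

/-- The mixed term is bounded: `|twistQ · θ̇| ≤ K`. [folklore] -/
theorem abs_q_dθ_le {τ : ℝ} (hτ : τ ∈ Icc d.tD d.tL) :
    |twistQ R.c (R.r τ) (R.θ τ) * (deriv R.Θ (d.H₁ τ) * deriv d.H₁ τ)| ≤ R.K := by
  have hq := R.twistQ_mem hτ
  have hq0 : 0 ≤ twistQ R.c (R.r τ) (R.θ τ) := R.qmin_pos.le.trans hq.1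
  have hΘ := R.Θ_deriv _ (R.hwin τ hτ)
  have hΘabs : |deriv R.Θ (d.H₁ τ)| ≤ R.MΘ := abs_le.2 ⟨hΘ.1, by linarith [R.mΘ_pos]⟩
  have hH := R.abs_deriv_H₁_le hτ
  rw [K, abs_mul, abs_mul, abs_of_nonneg hq0]
  have := mul_le_mul hΘabs hH (abs_nonneg _) R.MΘ_pos.le
  calc twistQ R.c (R.r τ) (R.θ τ) * (|deriv R.Θ (d.H₁ τ)| * |deriv d.H₁ τ|)
      ≤ R.qmax * (R.MΘ * R.MH') := mul_le_mul hq.2 this (by positivity) R.qmax_pos.le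
    _ = R.qmax * R.MΘ * R.MH' := by ring


/-! ### The radial speed -/

/-- `deriv_r_eq` (auxiliary). [folklore] -/
theorem deriv_r_eq {τ : ℝ} (hτ : τ ∈ Icc d.tD d.tL) :
    deriv R.r τ = -deriv d.X₁ τ * R.e (d.H₁ τ) + (1 - d.X₁ τ) * (deriv R.e (d.H₁ τ) * deriv d.H₁ τ) :=
  (R.hasDerivAt_r hτ).deriv

/-- **The radial speed is non-positive, and robust up to the landing smoothing**:
`ṙ ≤ -(1 - S (Xl)) · vmin e₋ / 2`. [folklore] -/
theorem deriv_r_le {τ : ℝ} (hτ : τ ∈ Icc d.tD d.tL) : deriv R.r τ ≤ -((1 - d.Sℓ (d.Xl τ)) * (d.vmin * R.emin / 2)) := by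
  rw [R.deriv_r_eq hτ, d.deriv_X₁_eq_I hτ, d.one_sub_X₁_eq hτ]
  have hS := d.Sℓ_mem (d.Xl τ)
  have hS' := d.deriv_Sℓ_nonneg (d.Xl τ)
  have hXl := d.Xl_mem_I hτ
  have hxD : d.xD = 1 - d.κD := rfl
  have h1x : 0 ≤ 1 - d.Xl τ := by linarith [hXl.2]
  have h1xκ : 1 - d.Xl τ ≤ d.κD := by rw [hxD] at hXl; linarith [hXl.1]
  have hv := d.vmin_le_dXl hτ
  have hX0 := d.deriv_Xl_nonneg_I hτ
  have he := R.e_mem hτ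
  have he' : |deriv R.e (d.H₁ τ)| ≤ R.Me := R.e_deriv _ (R.hwin τ hτ)
  have hH := R.abs_deriv_H₁_le hτ
  have hc1 := R.cond1
  -- `|(1 - Xl)(1 - S) e' H₁'| ≤ κ_D (1 - S) Me MḢ`
  have hmix : (1 - d.Xl τ) * (1 - d.Sℓ (d.Xl τ)) * (deriv R.e (d.H₁ τ) * deriv d.H₁ τ) ≤
      (1 - d.Sℓ (d.Xl τ)) * (d.κD * R.Me * R.MH') := by
    have habs : |deriv R.e (d.H₁ τ) * deriv d.H₁ τ| ≤ R.Me * R.MH' := by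
      rw [abs_mul]; exact mul_le_mul he' hH (abs_nonneg _) R.Me_nonneg
    have hle : deriv R.e (d.H₁ τ) * deriv d.H₁ τ ≤ R.Me * R.MH' := (le_abs_self _).trans habs
    have h0 : 0 ≤ (1 - d.Xl τ) * (1 - d.Sℓ (d.Xl τ)) := mul_nonneg h1x (by linarith [hS.2])
    calc (1 - d.Xl τ) * (1 - d.Sℓ (d.Xl τ)) * (deriv R.e (d.H₁ τ) * deriv d.H₁ τ)
        ≤ (1 - d.Xl τ) * (1 - d.Sℓ (d.Xl τ)) * (R.Me * R.MH') := mul_le_mul_of_nonneg_left hle h0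
      _ ≤ d.κD * (1 - d.Sℓ (d.Xl τ)) * (R.Me * R.MH') := by
          apply mul_le_mul_of_nonneg_right _ (mul_nonneg R.Me_nonneg R.MH'_pos.le)
          exact mul_le_mul_of_nonneg_right h1xκ (by linarith [hS.2])
      _ = (1 - d.Sℓ (d.Xl τ)) * (d.κD * R.Me * R.MH') := by ring
  -- the main radial term
  have hmain : ((1 - d.Sℓ (d.Xl τ)) + (1 - d.Xl τ) * deriv (smoothStep (1 - d.εℓ) 1) (d.Xl τ)) * deriv d.Xl τ * R.e (d.H₁ τ)
      ≥ (1 - d.Sℓ (d.Xl τ)) * (d.vmin * R.emin) := by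
    have h2 : (1 - d.Sℓ (d.Xl τ)) * deriv d.Xl τ * R.e (d.H₁ τ) ≥ (1 - d.Sℓ (d.Xl τ)) * (d.vmin * R.emin) := by
      have : d.vmin * R.emin ≤ deriv d.Xl τ * R.e (d.H₁ τ) :=
        mul_le_mul hv he.1 R.emin_pos.le hX0
      nlinarith [hS.2]
    have h3 : 0 ≤ (1 - d.Xl τ) * deriv (smoothStep (1 - d.εℓ) 1) (d.Xl τ) * deriv d.Xl τ * R.e (d.H₁ τ) :=
      mul_nonneg (mul_nonneg (mul_nonneg h1x hS') hX0) (R.e_pos hτ).le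
    nlinarith
  have hMH' : R.MH' = d.MH + d.ms * (1 + R.CT) * R.VX := rfl
  rw [← hMH'] at hc1
  nlinarith [hS.2]

/-- The radial speed is non-positive on `[t_D, t_L]`. [folklore] -/
theorem deriv_r_nonpos {τ : ℝ} (hτ : τ ∈ Icc d.tD d.tL) : deriv R.r τ ≤ 0 := by
  have h := R.deriv_r_le hτ
  have hS := d.Sℓ_mem (d.Xl τ)
  have : 0 ≤ (1 - d.Sℓ (d.Xl τ)) * (d.vmin * R.emin / 2) :=
    mul_nonneg (by linarith [hS.2]) (by nlinarith [d.vmin_pos, R.emin_pos])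
  linarith

/-- Up to the landing smoothing the radial speed is at most `-vmin e₋/2`. [folklore] -/
theorem deriv_r_lt {τ : ℝ} (hτ : τ ∈ Icc d.tD d.tL) (hX : d.Xl τ ≤ 1 - d.εℓ) : deriv R.r τ ≤ -(d.vmin * R.emin / 2) := by
  have h := R.deriv_r_le hτ
  rw [d.Sℓ_of_le hX] at h
  linarith


/-! ### The bend zone ends before the landing smoothing -/

/-- `tu_lt_tℓ` (auxiliary). [folklore] -/
theorem tu_lt_tℓ (R : RouteHyp d) : d.tu < d.tℓ := by
  by_contra h
  have := d.Xl_le_Xl (le_of_not_gt h) (by linarith [d.tu_mem.2, d.ε_pos] : d.tu ≤ d.b + d.ε)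
  rw [d.Xl_tu, d.Xl_tℓ, K2LiteData.xD] at this
  linarith [R.u₁_half, d.εℓ_le, d.κD_pos]

/-- `tu_I` (auxiliary). [folklore] -/
theorem tu_I (R : RouteHyp d) : d.tu ∈ Icc d.tD d.tL := ⟨d.tD_lt_tu.le, ((R.tu_lt_tℓ).trans d.tℓ_lt_tL).le⟩
/-- `tℓ_I` (auxiliary). [folklore] -/
theorem tℓ_I (R : RouteHyp d) : d.tℓ ∈ Icc d.tD d.tL := ⟨(d.tD_lt_tu.trans R.tu_lt_tℓ).le, d.tℓ_lt_tL.le⟩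

/-! ### The twist angle along the route -/

/-- `H₁_tD` (auxiliary). [folklore] -/
theorem H₁_tD : d.H₁ d.tD = d.Hh d.tD := by
  rw [d.H₁_eq_P ⟨le_rfl, d.tD_lt_tL.le⟩, d.P_of_Xg_le (by rw [d.Xg_tD])]

/-- `X₁_tD` (auxiliary). [folklore] -/
theorem X₁_tD : d.X₁ d.tD = d.xD := by
  rw [d.X₁_eq_Xl_I ⟨le_rfl, d.tD_lt_tL.le⟩ (by rw [d.Xl_tD, K2LiteData.xD]; linarith [d.εℓ_lt_κD]), d.Xl_tD]

/-- The tip radius `r t_D = 1 + κ_D e (h_D)`. [folklore] -/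
theorem r_tD : R.r d.tD = 1 + d.κD * R.e (d.Hh d.tD) := by
  rw [r, X₁_tD, H₁_tD, K2LiteData.xD]; ring

/-- `θ_tD` (auxiliary). [folklore] -/
theorem θ_tD : R.θ d.tD = R.Θ (d.Hh d.tD) := by rw [θ, H₁_tD]

/-- **At the tip the twist angle is `π/2`.** [folklore] -/
theorem α_tD : R.α d.tD = π / 2 := by
  rw [α, twistAngle, R.r_tD, R.θ_tD, R.tip, arctan_one]; ring

/-- The derivative data of the curve on `[t_D, t_L]`, in the form used by the comparison lemmas. [folklore] -/
theorem hasDerivAt_r' {τ : ℝ} (hτ : τ ∈ Icc d.tD d.tL) : HasDerivAt R.r (deriv R.r τ) τ := by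
  have := R.hasDerivAt_r hτ; rwa [← this.deriv] at this

/-- `hasDerivAt_θ'` (auxiliary). [folklore] -/
theorem hasDerivAt_θ' {τ : ℝ} (hτ : τ ∈ Icc d.tD d.tL) : HasDerivAt R.θ (deriv R.Θ (d.H₁ τ) * deriv d.H₁ τ) τ :=
  R.hasDerivAt_θ hτ

/-- **The twist angle stays within `s` of the vertical on `[t_D, t_L]`.** [folklore] -/
theorem abs_α_sub_le {τ : ℝ} (hτ : τ ∈ Icc d.tD d.tL) : |R.α τ - π / 2| ≤ R.s := by
  have hI : ∀ t ∈ Icc d.tD τ, t ∈ Icc d.tD d.tL := fun t ht ↦ ⟨ht.1, ht.2.trans hτ.2⟩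
  have hge := twistAngle_curve_ge_lip_abs (c := R.c) (r := R.r) (θ := R.θ) (dr := deriv R.r)
    (dθ := fun t ↦ deriv R.Θ (d.H₁ t) * deriv d.H₁ t) (t₁ := d.tD) (t₂ := τ) hτ.1
    (fun t ht ↦ R.hasDerivAt_r' (hI t ht)) (fun t ht ↦ R.hasDerivAt_θ' (hI t ht))
    (fun t ht ↦ R.θ_mem_Ioo (hI t ht)) (fun t ht ↦ R.deriv_r_nonpos (hI t ht))
    (K := R.K) (fun t ht ↦ (abs_le.1 (R.abs_q_dθ_le (hI t ht))).1) (t := τ) ⟨hτ.1, le_rfl⟩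
  have hle := twistAngle_curve_le_lip_abs (c := R.c) (r := R.r) (θ := R.θ) (dr := deriv R.r)
    (dθ := fun t ↦ deriv R.Θ (d.H₁ t) * deriv d.H₁ t) (t₁ := d.tD) (t₂ := τ) hτ.1
    (fun t ht ↦ R.hasDerivAt_r' (hI t ht)) (fun t ht ↦ R.hasDerivAt_θ' (hI t ht))
    (fun t ht ↦ R.θ_mem_Ioo (hI t ht)) (fun t ht ↦ R.deriv_r_nonpos (hI t ht))
    (K := R.K) (fun t ht ↦ (abs_le.1 (R.abs_q_dθ_le (hI t ht))).2) (t := τ) ⟨hτ.1, le_rfl⟩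
  have hαD : twistAngle R.c (R.r d.tD) (R.θ d.tD) = π / 2 := R.α_tD
  rw [hαD] at hge hle
  have htime := d.sub_tD_le hτ
  have hr := R.r_mem hτ
  have hrD : R.r d.tD ≤ 1 + d.κD * R.emax := (R.r_mem ⟨le_rfl, d.tD_lt_tL.le⟩).2
  have hKt : R.K * (τ - d.tD) ≤ R.K * d.κD / d.vmin := by
    rw [mul_div_assoc]; exact mul_le_mul_of_nonneg_left htime R.K_pos.le
  have hcr : -(|R.c| * d.κD * R.emax) ≤ |R.c| * (R.r τ - R.r d.tD) := by nlinarith [abs_nonneg R.c, hr.1]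
  have hcr' : |R.c| * (R.r d.tD - R.r τ) ≤ |R.c| * d.κD * R.emax := by nlinarith [abs_nonneg R.c, hr.1]
  have h0 : 0 ≤ |R.c| * d.κD * R.emax := by
    have := d.κD_pos; have := R.emax_pos; positivity
  rw [abs_le, s, α]
  constructor <;> linarith

/-- `α_le` (auxiliary). [folklore] -/
theorem α_le {τ : ℝ} (hτ : τ ∈ Icc d.tD d.tL) : R.α τ ≤ π / 2 + R.s := by
  have := (abs_le.1 (R.abs_α_sub_le hτ)).2; linarith

/-- `le_α` (auxiliary). [folklore] -/
theorem le_α {τ : ℝ} (hτ : τ ∈ Icc d.tD d.tL) : π / 2 - R.s ≤ R.α τ := by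
  have := (abs_le.1 (R.abs_α_sub_le hτ)).1; linarith

/-- `|cos α| ≤ s` on `[t_D, t_L]`. [folklore] -/
theorem abs_cos_α_le {τ : ℝ} (hτ : τ ∈ Icc d.tD d.tL) : |cos (R.α τ)| ≤ R.s := by
  have h : cos (R.α τ) = sin (π / 2 - R.α τ) := by rw [sin_pi_div_two_sub]
  rw [h]
  refine (Real.abs_sin_le_abs).trans ?_
  rw [abs_sub_comm]; exact R.abs_α_sub_le hτ

/-- `sin α ≥ 1/2` on `[t_D, t_L]`. [folklore] -/
theorem half_le_sin_α {τ : ℝ} (hτ : τ ∈ Icc d.tD d.tL) : 1 / 2 ≤ sin (R.α τ) := by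
  have h : sin (R.α τ) = cos (R.α τ - π / 2) := by rw [← cos_sub_pi_div_two]
  rw [h]
  have hb := R.abs_α_sub_le hτ
  have hs := R.s_le_half
  have hc := Real.one_sub_sq_div_two_le_cos (x := R.α τ - π / 2)
  have hsq : (R.α τ - π / 2) ^ 2 ≤ (1 / 2) ^ 2 := by
    have := abs_le.1 hb
    nlinarith [this.1, this.2, R.s_nonneg]
  nlinarith

/-- `sin_α_pos` (auxiliary). [folklore] -/
theorem sin_α_pos {τ : ℝ} (hτ : τ ∈ Icc d.tD d.tL) : 0 < sin (R.α τ) := by linarith [R.half_le_sin_α hτ]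

/-- `α_lt_pi` (auxiliary). [folklore] -/
theorem α_lt_pi {τ : ℝ} (hτ : τ ∈ Icc d.tD d.tL) : R.α τ < π := by
  linarith [R.α_le hτ, R.s_le_half, Real.two_le_pi]

/-- `1 + r c cos α ≥ 1/2 ≥ 0` on `[t_D, t_L]`. [folklore] -/
theorem band {τ : ℝ} (hτ : τ ∈ Icc d.tD d.tL) : -1 / 2 ≤ R.r τ * R.c * cos (R.α τ) := by
  have hcos := R.abs_cos_α_le hτ
  have hr := R.r_le_two hτ; have hr0 := R.r_pos hτ
  have hcs := R.cs_le
  have habs : |R.r τ * R.c * cos (R.α τ)| ≤ R.r τ * |R.c| * R.s := by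
    rw [abs_mul, abs_mul, abs_of_pos hr0]
    exact mul_le_mul_of_nonneg_left hcos (mul_nonneg hr0.le (abs_nonneg _))
  have := neg_abs_le (R.r τ * R.c * cos (R.α τ))
  nlinarith [mul_nonneg hr0.le (abs_nonneg R.c), R.s_nonneg, mul_nonneg (abs_nonneg R.c) R.s_nonneg]

/-! ### The derivative of the twisted height -/

/-- The derivative of `y` along the route. [folklore] -/
theorem hasDerivAt_y {τ : ℝ} (hτ : τ ∈ Icc d.tD d.tL) :
    HasDerivAt R.y (deriv R.r τ * sin (R.α τ) +
      R.r τ * (cos (R.α τ) * (R.c * sin (R.α τ) * deriv R.r τ +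
        twistQ R.c (R.r τ) (R.θ τ) * (deriv R.Θ (d.H₁ τ) * deriv d.H₁ τ)))) τ :=
  hasDerivAt_curveY R.c (R.hasDerivAt_r' hτ) (R.hasDerivAt_θ' hτ) (R.θ_mem_Ioo hτ)

/-- **Up to the landing smoothing, `ẏ < 0`** (near-vertical criterion). [folklore] -/
theorem deriv_y_neg_of_le_tℓ {τ : ℝ} (hτ : τ ∈ Icc d.tD d.tL) (hℓ : τ ≤ d.tℓ) : deriv R.y τ < 0 := by
  rw [(R.hasDerivAt_y hτ).deriv]
  have hX : d.Xl τ ≤ 1 - d.εℓ := d.Xl_le_of_le_tℓ hℓ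
  have hr' := R.deriv_r_lt hτ hX
  have hvm : 0 < d.vmin * R.emin / 2 := by nlinarith [d.vmin_pos, R.emin_pos]
  have hq := R.twistQ_mem hτ
  refine curveY_deriv_neg_of_nearVertical_abs (R.r_pos hτ) (by linarith) (R.sin_α_pos hτ)
    (R.qmin_pos.le.trans hq.1) (R.abs_cos_α_le hτ) ?_ ?_
  · have := R.cs_le; have hr := R.r_le_two hτ
    nlinarith [mul_nonneg (abs_nonneg R.c) R.s_nonneg, R.r_pos hτ]
  · -- mixed term: `r q |θ̇| s ≤ 2 K s < vmin e₋ / 8 ≤ -ṙ sin α / 2`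
    have hK := R.abs_q_dθ_le hτ
    have hq0 : 0 ≤ twistQ R.c (R.r τ) (R.θ τ) := R.qmin_pos.le.trans hq.1
    have hqθ : twistQ R.c (R.r τ) (R.θ τ) * |deriv R.Θ (d.H₁ τ) * deriv d.H₁ τ| ≤ R.K := by
      rwa [abs_mul, abs_of_nonneg hq0] at hK
    have hr := R.r_le_two hτ; have hr0 := R.r_pos hτ
    have hKs := R.Ks_lt
    have hsin := R.half_le_sin_α hτ
    have h1 : R.r τ * twistQ R.c (R.r τ) (R.θ τ) * |deriv R.Θ (d.H₁ τ) * deriv d.H₁ τ| * R.s ≤ 2 * R.K * R.s := by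
      have : R.r τ * (twistQ R.c (R.r τ) (R.θ τ) * |deriv R.Θ (d.H₁ τ) * deriv d.H₁ τ|) ≤ 2 * R.K :=
        mul_le_mul hr hqθ (mul_nonneg hq0 (abs_nonneg _)) (by norm_num)
      have := mul_le_mul_of_nonneg_right this R.s_nonneg
      linarith [this]
    have h2 : d.vmin * R.emin / 8 ≤ -deriv R.r τ * sin (R.α τ) / 2 := by
      have : d.vmin * R.emin / 2 * (1 / 2) ≤ -deriv R.r τ * sin (R.α τ) :=
        mul_le_mul (by linarith) hsin (by norm_num) (by linarith)
      linarith
    linarith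

/-! ### The climb: the route crosses the vertical before the landing smoothing -/

/-- From the end of the bend zone on, the bend is at full slope: `ζ' = 1`. [folklore] -/
theorem deriv_ζ_eq_one {τ : ℝ} (hτ : τ ∈ Icc d.tD d.tL) (hu : d.tu ≤ τ) : deriv d.ζ (d.Xl τ - d.xD) = 1 :=
  d.deriv_ζ_of_ge (by linarith [d.le_Xl_of_tu_le hu (d.le_bε hτ)])

/-- From the end of the bend zone on, the height decreases at rate at least `MH`:
`H₁' ≤ MH - m_s Xl' ≤ -MH`. [folklore] -/
theorem deriv_H₁_le_of_tu_le {τ : ℝ} (hτ : τ ∈ Icc d.tD d.tL) (hu : d.tu ≤ τ) :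
    deriv d.H₁ τ ≤ d.MH - d.ms * deriv d.Xl τ := by
  rw [d.deriv_H₁_eq_I hτ, deriv_ζ_eq_one hτ hu, one_mul]
  linarith [d.deriv_Hh_le_MH ⟨(d.I_sub hτ).1, d.le_bε hτ⟩]

/-- `deriv_H₁_neg_of_tu_le` (auxiliary). [folklore] -/
theorem deriv_H₁_neg_of_tu_le {τ : ℝ} (hτ : τ ∈ Icc d.tD d.tL) (hu : d.tu ≤ τ) : deriv d.H₁ τ ≤ -d.MH := by
  have h := deriv_H₁_le_of_tu_le hτ hu
  have hv := d.vmin_le_dXl hτ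
  nlinarith [d.ms_large, mul_le_mul_of_nonneg_left hv d.ms_pos.le]

/-- From the end of the bend zone on, the slice angle increases: `θ̇ ≥ m_Θ MH > 0`. [folklore] -/
theorem dθ_pos_of_tu_le {τ : ℝ} (hτ : τ ∈ Icc d.tD d.tL) (hu : d.tu ≤ τ) :
    R.mΘ * d.MH ≤ deriv R.Θ (d.H₁ τ) * deriv d.H₁ τ := by
  have hH := deriv_H₁_neg_of_tu_le hτ hu
  have hΘ := (R.Θ_deriv _ (R.hwin τ hτ)).2
  have hMH := d.MH_pos
  nlinarith [mul_le_mul_of_nonpos_right hΘ (by linarith : deriv d.H₁ τ ≤ 0), R.mΘ_pos]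

/-- **The climb**: on `[t_u, t_L]`, `θ - (m_Θ m_s / 2) Xl` is non-decreasing. [folklore] -/
theorem climb {σ τ : ℝ} (hσ : σ ∈ Icc d.tu d.tL) (hτ : τ ∈ Icc d.tu d.tL) (hστ : σ ≤ τ) :
    R.mΘ * d.ms / 2 * (d.Xl τ - d.Xl σ) ≤ R.θ τ - R.θ σ := by
  have hI : ∀ t ∈ Icc d.tu d.tL, t ∈ Icc d.tD d.tL := fun t ht ↦ ⟨d.tD_lt_tu.le.trans ht.1, ht.2⟩
  have hmono : MonotoneOn (fun u ↦ R.θ u - R.mΘ * d.ms / 2 * d.Xl u) (Icc d.tu d.tL) := by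
    have hd : ∀ u ∈ Icc d.tu d.tL, HasDerivAt (fun u ↦ R.θ u - R.mΘ * d.ms / 2 * d.Xl u)
        (deriv R.Θ (d.H₁ u) * deriv d.H₁ u - R.mΘ * d.ms / 2 * deriv d.Xl u) u := fun u hu ↦
      (R.hasDerivAt_θ' (hI u hu)).sub ((d.contDiff_Xl.differentiable (by simp) u).hasDerivAt.const_mul _)
    refine monotoneOn_of_deriv_nonneg (convex_Icc _ _) ?_ ?_ ?_
    · exact fun u hu ↦ (hd u hu).continuousAt.continuousWithinAt
    · intro u hu
      rw [interior_Icc] at hu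
      exact (hd u (Ioo_subset_Icc_self hu)).differentiableAt.differentiableWithinAt
    · intro u hu
      rw [interior_Icc] at hu
      have hu' := Ioo_subset_Icc_self hu
      rw [(hd u hu').deriv]
      have hH := deriv_H₁_le_of_tu_le (hI u hu') hu'.1
      have hΘ := (R.Θ_deriv _ (R.hwin u (hI u hu'))).2
      have hv := d.vmin_le_dXl (hI u hu')
      have hX0 := d.deriv_Xl_nonneg_I (hI u hu')
      -- `Θ' H₁' ≥ mΘ (ms Xl' - MH)` and `ms Xl'/2 ≥ MH`
      have h1 : R.mΘ * (d.ms * deriv d.Xl u - d.MH) ≤ deriv R.Θ (d.H₁ u) * deriv d.H₁ u := by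
        have hneg : deriv d.H₁ u ≤ 0 := by
          nlinarith [d.ms_large, mul_le_mul_of_nonneg_left hv d.ms_pos.le, d.MH_pos]
        nlinarith [mul_le_mul_of_nonpos_right hΘ hneg, R.mΘ_pos]
      nlinarith [d.ms_large, mul_le_mul_of_nonneg_left hv d.ms_pos.le, R.mΘ_pos]
  have := hmono hσ hτ hστ
  simp only at this
  linarith

/-- The height moves by at most `MḢ |Δτ|` on `[t_D, t_L]`. [folklore] -/
theorem abs_H₁_sub_le {σ τ : ℝ} (hσ : σ ∈ Icc d.tD d.tL) (hτ : τ ∈ Icc d.tD d.tL) :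
    |d.H₁ τ - d.H₁ σ| ≤ R.MH' * |τ - σ| := by
  have h := Convex.norm_image_sub_le_of_norm_deriv_le (f := d.H₁) (s := Icc d.tD d.tL) (C := R.MH')
    (fun x _ ↦ d.contDiff_H₁.differentiable (by simp) x) (fun x hx ↦ by
      rw [Real.norm_eq_abs]; exact R.abs_deriv_H₁_le hx) (convex_Icc _ _) hσ hτ
  simpa [Real.norm_eq_abs] using h

/-- The edge rate is `Me`-Lipschitz on the window. [folklore] -/
theorem abs_e_sub_le {h h' : ℝ} (hh : h ∈ Ioo R.w₁ R.w₂) (hh' : h' ∈ Ioo R.w₁ R.w₂) :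
    |R.e h' - R.e h| ≤ R.Me * |h' - h| := by
  have hconv : Convex ℝ (Ioo R.w₁ R.w₂) := convex_Ioo _ _
  have h := Convex.norm_image_sub_le_of_norm_deriv_le (f := R.e) (s := Ioo R.w₁ R.w₂) (C := R.Me)
    (fun x hx ↦ (R.e_smooth.differentiableOn (by simp)).differentiableAt (Ioo_mem_nhds hx.1 hx.2))
    (fun x hx ↦ by rw [Real.norm_eq_abs]; exact R.e_deriv x hx) hconv hh hh'
  simpa [Real.norm_eq_abs] using h

/-- **At the end of the bend zone the twist angle has lost at most `u₁ L₁`.** [folklore] -/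
theorem α_tu_ge : π / 2 - d.u₁ * R.L₁ ≤ R.α d.tu := by
  have htu : d.tu ∈ Icc d.tD d.tL := R.tu_I
  have hI : ∀ t ∈ Icc d.tD d.tu, t ∈ Icc d.tD d.tL := fun t ht ↦ ⟨ht.1, ht.2.trans htu.2⟩
  have hge := twistAngle_curve_ge_lip_abs (c := R.c) (r := R.r) (θ := R.θ) (dr := deriv R.r)
    (dθ := fun t ↦ deriv R.Θ (d.H₁ t) * deriv d.H₁ t) (t₁ := d.tD) (t₂ := d.tu) htu.1
    (fun t ht ↦ R.hasDerivAt_r' (hI t ht)) (fun t ht ↦ R.hasDerivAt_θ' (hI t ht))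
    (fun t ht ↦ R.θ_mem_Ioo (hI t ht)) (fun t ht ↦ R.deriv_r_nonpos (hI t ht))
    (K := R.K) (fun t ht ↦ (abs_le.1 (R.abs_q_dθ_le (hI t ht))).1) (t := d.tu) ⟨htu.1, le_rfl⟩
  have hαD : twistAngle R.c (R.r d.tD) (R.θ d.tD) = π / 2 := R.α_tD
  rw [hαD] at hge
  -- time to the end of the bend zone
  have htime : d.tu - d.tD ≤ d.u₁ / d.vmin := by
    rw [le_div_iff₀ d.vmin_pos]
    have h := d.time_le_tD htu
    rw [d.Xl_tu] at h; linarith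
  -- the radius lost: `r_D - r t_u ≤ u₁ e₊ + κ_D Me MḢ u₁ / vmin`
  have hXtu : d.X₁ d.tu = d.xD + d.u₁ := by
    rw [d.X₁_eq_Xl_I htu (by rw [d.Xl_tu, K2LiteData.xD]; linarith [R.u₁_half, d.εℓ_le, d.κD_pos]), d.Xl_tu]
  have hrtu : R.r d.tu = 1 + (d.κD - d.u₁) * R.e (d.H₁ d.tu) := by rw [r, hXtu, K2LiteData.xD]; ring
  have hHtu : |d.H₁ d.tu - d.H₁ d.tD| ≤ R.MH' * (d.u₁ / d.vmin) := by
    have h := R.abs_H₁_sub_le ⟨le_rfl, d.tD_lt_tL.le⟩ htu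
    rw [abs_of_nonneg (by linarith [htu.1] : 0 ≤ d.tu - d.tD)] at h
    exact h.trans (mul_le_mul_of_nonneg_left htime R.MH'_pos.le)
  have hetu : |R.e (d.H₁ d.tu) - R.e (d.Hh d.tD)| ≤ R.Me * (R.MH' * (d.u₁ / d.vmin)) := by
    have h := R.abs_e_sub_le (h := d.Hh d.tD) (h' := d.H₁ d.tu) (by rw [← H₁_tD]; exact R.hwin _ ⟨le_rfl, d.tD_lt_tL.le⟩)
      (R.hwin _ htu)
    rw [← H₁_tD] at h ⊢
    exact h.trans (mul_le_mul_of_nonneg_left hHtu R.Me_nonneg)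
  have hetu' := (abs_le.1 hetu)
  have heD := R.e_mem ⟨le_rfl, d.tD_lt_tL.le⟩
  rw [H₁_tD] at heD
  have hetu2 := R.e_mem htu
  have hκu : 0 ≤ d.κD - d.u₁ := by linarith [R.u₁_half, d.κD_pos]
  -- `|c| (r t_u - r_D) ≥ -|c| (u₁ e₊ + κ_D Me MḢ u₁ / vmin)`
  have hcr : -(|R.c| * (d.u₁ * R.emax + d.κD * R.Me * R.MH' * d.u₁ / d.vmin)) ≤ |R.c| * (R.r d.tu - R.r d.tD) := by
    rw [hrtu, R.r_tD]
    have h1 : (d.κD - d.u₁) * R.e (d.H₁ d.tu) - d.κD * R.e (d.Hh d.tD) =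
        d.κD * (R.e (d.H₁ d.tu) - R.e (d.Hh d.tD)) - d.u₁ * R.e (d.H₁ d.tu) := by ring
    have h2 : -(d.κD * (R.Me * (R.MH' * (d.u₁ / d.vmin)))) ≤ d.κD * (R.e (d.H₁ d.tu) - R.e (d.Hh d.tD)) :=
      by nlinarith [hetu'.1, d.κD_pos]
    have h3 : d.u₁ * R.e (d.H₁ d.tu) ≤ d.u₁ * R.emax := mul_le_mul_of_nonneg_left hetu2.2 d.u₁_pos.le
    have h4 : |R.c| * ((d.κD - d.u₁) * R.e (d.H₁ d.tu) - d.κD * R.e (d.Hh d.tD)) ≥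
        |R.c| * (-(d.κD * (R.Me * (R.MH' * (d.u₁ / d.vmin)))) - d.u₁ * R.emax) := by
      rw [h1]; exact mul_le_mul_of_nonneg_left (by linarith) (abs_nonneg _)
    have e5 : |R.c| * (-(d.κD * (R.Me * (R.MH' * (d.u₁ / d.vmin)))) - d.u₁ * R.emax) =
        -(|R.c| * (d.u₁ * R.emax + d.κD * R.Me * R.MH' * d.u₁ / d.vmin)) := by ring
    have e6 : 1 + (d.κD - d.u₁) * R.e (d.H₁ d.tu) - (1 + d.κD * R.e (d.Hh d.tD)) =
        (d.κD - d.u₁) * R.e (d.H₁ d.tu) - d.κD * R.e (d.Hh d.tD) := by ring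
    rw [e6]; linarith
  have hKt : R.K * (d.tu - d.tD) ≤ R.K * (d.u₁ / d.vmin) := mul_le_mul_of_nonneg_left htime R.K_pos.le
  rw [α, L₁]
  have e7 : d.u₁ * (|R.c| * R.emax + |R.c| * d.κD * R.Me * R.MH' / d.vmin + R.K / d.vmin) =
      |R.c| * (d.u₁ * R.emax + d.κD * R.Me * R.MH' * d.u₁ / d.vmin) + R.K * (d.u₁ / d.vmin) := by ring
  rw [e7]; linarith

/-- **Beyond the landing smoothing the route has crossed the vertical: `α > π/2`.** [folklore] -/
theorem α_gt_of_tℓ_le {τ : ℝ} (hτ : τ ∈ Icc d.tD d.tL) (hℓ : d.tℓ ≤ τ) : π / 2 < R.α τ := by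
  have htu : d.tu ∈ Icc d.tD d.tL := R.tu_I
  have huτ : d.tu ≤ τ := (R.tu_lt_tℓ.le).trans hℓ
  have hI : ∀ t ∈ Icc d.tu τ, t ∈ Icc d.tD d.tL := fun t ht ↦ ⟨htu.1.trans ht.1, ht.2.trans hτ.2⟩
  have hge := twistAngle_curve_ge_abs (c := R.c) (r := R.r) (θ := R.θ) (dr := deriv R.r)
    (dθ := fun t ↦ deriv R.Θ (d.H₁ t) * deriv d.H₁ t) (t₁ := d.tu) (t₂ := τ) huτ
    (fun t ht ↦ R.hasDerivAt_r' (hI t ht)) (fun t ht ↦ R.hasDerivAt_θ' (hI t ht))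
    (fun t ht ↦ R.θ_mem_Ioo (hI t ht)) (fun t ht ↦ R.deriv_r_nonpos (hI t ht))
    (fun t ht ↦ by have := R.dθ_pos_of_tu_le (hI t ht) ht.1; nlinarith [R.mΘ_pos, d.MH_pos])
    (qmin := R.qmin) (fun t ht ↦ (R.twistQ_mem (hI t ht)).1) (t := τ) ⟨huτ, le_rfl⟩
  have hclimb := R.climb ⟨le_rfl, htu.2⟩ ⟨huτ, hτ.2⟩ huτ
  have hXτ : 1 - d.εℓ ≤ d.Xl τ := d.le_Xl_of_tℓ_le hℓ (d.le_bε hτ)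
  have hΔX : d.κD / 4 ≤ d.Xl τ - d.Xl d.tu := by
    rw [d.Xl_tu, K2LiteData.xD]; linarith [R.u₁_half, d.εℓ_le]
  have hαu := R.α_tu_ge
  have hr := R.r_mem hτ; have hru := R.r_mem htu
  have hcr : -(|R.c| * d.κD * R.emax) ≤ |R.c| * (R.r τ - R.r d.tu) := by nlinarith [abs_nonneg R.c, hr.1, hru.2]
  have hqθ : R.qmin * (R.mΘ * d.ms / 2 * (d.κD / 4)) ≤ R.qmin * (R.θ τ - R.θ d.tu) :=
    mul_le_mul_of_nonneg_left ((mul_le_mul_of_nonneg_left hΔX (by nlinarith [R.mΘ_pos, d.ms_pos])).trans hclimb)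
      R.qmin_pos.le
  have hgt := R.climb_gt
  have e1 : R.qmin * (R.mΘ * d.ms / 2 * (d.κD / 4)) = R.qmin * R.mΘ * d.ms * d.κD / 8 := by ring
  rw [e1] at hqθ
  change π / 2 < twistAngle R.c (R.r τ) (R.θ τ)
  change π / 2 - d.u₁ * R.L₁ ≤ twistAngle R.c (R.r d.tu) (R.θ d.tu) at hαu
  linarith

/-- **On the landing smoothing, `ẏ < 0`** (landed criterion). [folklore] -/
theorem deriv_y_neg_of_tℓ_le {τ : ℝ} (hτ : τ ∈ Icc d.tD d.tL) (hℓ : d.tℓ ≤ τ) : deriv R.y τ < 0 := by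
  rw [(R.hasDerivAt_y hτ).deriv]
  have hα := R.α_gt_of_tℓ_le hτ hℓ
  have hαπ := R.α_lt_pi hτ
  have hcos : cos (R.α τ) < 0 := cos_neg_of_pi_div_two_lt_of_lt hα (by linarith)
  have hq := R.twistQ_mem hτ
  have hθ' : 0 < deriv R.Θ (d.H₁ τ) * deriv d.H₁ τ := by
    have := R.dθ_pos_of_tu_le hτ (R.tu_lt_tℓ.le.trans hℓ); nlinarith [R.mΘ_pos, d.MH_pos]
  refine curveY_deriv_neg_of_landed (R.r_pos hτ) (R.deriv_r_nonpos hτ) hθ' (R.sin_α_pos hτ).le hcos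
    (R.qmin_pos.trans_le hq.1) ?_
  have := R.band hτ; linarith

/-- **`ẏ < 0` everywhere on `[t_D, t_L]`.** [folklore] -/
theorem deriv_y_neg {τ : ℝ} (hτ : τ ∈ Icc d.tD d.tL) : deriv R.y τ < 0 := by
  rcases le_or_gt τ d.tℓ with h | h
  · exact R.deriv_y_neg_of_le_tℓ hτ h
  · exact R.deriv_y_neg_of_tℓ_le hτ h.le

/-- **The twisted height is strictly decreasing along the route from the tip to the landing.**
[cite: Kirby1989, Ch. I §4] -/
theorem strictAntiOn_y : StrictAntiOn R.y (Icc d.tD d.tL) := by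
  refine strictAntiOn_of_deriv_neg (convex_Icc _ _) ?_ ?_
  · exact fun τ hτ ↦ (R.hasDerivAt_y hτ).continuousAt.continuousWithinAt
  · intro τ hτ
    rw [interior_Icc] at hτ
    exact R.deriv_y_neg (Ioo_subset_Icc_self hτ)

/-! ### By-products at the two ends -/

/-- At the tip, `y = r_D`. [folklore] -/
theorem y_tD : R.y d.tD = 1 + d.κD * R.e (d.Hh d.tD) := by
  rw [y, R.α_tD, sin_pi_div_two, mul_one, R.r_tD]

/-- At the landing, `r = 1`. [folklore] -/
theorem r_tL : R.r d.tL = 1 := by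
  rw [r, d.X₁_of_tL_le le_rfl]; ring

/-- **At the landing the route is strictly left of the vertical**: `π/2 < α t_L ≤ π/2 + s`.
[folklore] -/
theorem α_tL_mem : R.α d.tL ∈ Ioc (π / 2) (π / 2 + R.s) :=
  ⟨R.α_gt_of_tℓ_le ⟨d.tD_lt_tL.le, le_rfl⟩ d.tℓ_lt_tL.le, R.α_le ⟨d.tD_lt_tL.le, le_rfl⟩⟩

/-- At the landing the slice angle increases: `θ̇ t_L > 0`. [folklore] -/
theorem dθ_tL_pos : 0 < deriv R.Θ (d.H₁ d.tL) * deriv d.H₁ d.tL := by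
  have := R.dθ_pos_of_tu_le ⟨d.tD_lt_tL.le, le_rfl⟩ (R.tu_lt_tℓ.le.trans d.tℓ_lt_tL.le)
  nlinarith [R.mΘ_pos, d.MH_pos]

end RouteHyp

end Literature.Topology.FourManifolds
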